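/-
Copyright: pub-rosobs cell (Resolution Observatory), carver gen 39.  Companion file; statements OURS, in
the cell's polynomial weighted-centre model `W(f)`.  Instrument — NOT a resolution theorem.
-/
import Literature.AlgebraicGeometry.Resolution.WeightedCentreStep
import Mathlib.Algebra.MvPolynomial.Monad
import HarnessLib

/-!
# Base change of centres: `W_k(f) ⊆ W_K(f ⊗ K)`

[cite: CossartJannsenSaito2020, Lemma 2.27 (1) (p. 30) (quasi-étale base change: `C_{x'}(X') ≅ C_x(X) ×_{k(x)} k(x')`,
Hilbert–Samuel data and, for separable residue extensions, the directrix are compatible) and Lemma 2.10 (3)];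
[cite: AbramovichTemkinWlodarczyk2024, Thm. 5.3.1 (3) (p. 1578) (the invariant is functorial for smooth
morphisms: `inv_{p'}(I·O_{Y₁}) = inv_{f(p')}(I)`) and Thm. 1.1.1 (the resolution functor is functorial for smooth morphisms)].

In the polynomial model `W(f)` = `admissibleInvariants f` (carver g≤36) a centre is a pair (coordinate
change `Ψ`, weights `γ`) with `v_γ(Ψ⁻¹ f) ≥ 1`.  For a ring map of fields `φ : k → K` every centre of
`f ∈ k[x]` base-changes to a centre of `f ⊗ K = map φ f ∈ K[x]` with the same weights
(`baseChange Ψ`: `X_i ↦ map φ (Ψ X_i)`), so `W_k(f) ⊆ W_K(map φ f)` (`admissibleInvariants_subset_baseChange`)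
and a maximum over `K` that is already attained over `k` is the maximum over `k`
(`IsMaxInv.of_baseChange`).  This is the EASY half of the base-change reading used by the census at closed
points of residue degree `e > 1` (max over `𝔽_p` read as max over `GF(p^e)`); the converse (the maximum
does not grow under separable base change) is the functoriality theorem cited above and is NOT proved here.
-/

noncomputable section

open MvPolynomial

namespace Literature.AlgebraicGeometry.Resolution.WeightedBlowup

variable {k K : Type*} [Field k] [Field K] (φ : k →+* K) {σ : Type*}

/-- A polynomial automorphism is substitution of its values on the variables (plumbing). [folklore] -/
private theorem bind₁_algEquiv_apply (Ψ : MvPolynomial σ k ≃ₐ[k] MvPolynomial σ k)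
    (q : MvPolynomial σ k) : bind₁ (fun i => Ψ (X i)) q = Ψ q := by
  have h : (bind₁ fun i => Ψ (X i)) = (Ψ : MvPolynomial σ k →ₐ[k] MvPolynomial σ k) :=
    algHom_ext fun i => by rw [bind₁_X_right]; rfl
  exact DFunLike.congr_fun h q

/-- The base-changed substitution `X_i ↦ map φ (Ψ X_i)` as an algebra map (plumbing). [folklore] -/
private def baseChangeHom (Ψ : MvPolynomial σ k ≃ₐ[k] MvPolynomial σ k) :
    MvPolynomial σ K →ₐ[K] MvPolynomial σ K :=
  aeval fun i => map φ (Ψ (X i))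

/-- `baseChangeHom Ψ (map φ q) = map φ (Ψ q)` (plumbing). [folklore] -/
private theorem baseChangeHom_map (Ψ : MvPolynomial σ k ≃ₐ[k] MvPolynomial σ k) (q : MvPolynomial σ k) :
    baseChangeHom φ Ψ (map φ q) = map φ (Ψ q) := by
  rw [baseChangeHom, aeval_eq_bind₁, ← map_bind₁, bind₁_algEquiv_apply]

/-- The two base-changed substitutions of `Ψ`, `Ψ⁻¹` are inverse (plumbing). [folklore] -/
private theorem baseChangeHom_comp_symm (Ψ : MvPolynomial σ k ≃ₐ[k] MvPolynomial σ k) :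
    (baseChangeHom φ Ψ).comp (baseChangeHom φ Ψ.symm) = AlgHom.id K _ := by
  refine algHom_ext fun i => ?_
  rw [AlgHom.comp_apply, AlgHom.id_apply]
  have h1 : baseChangeHom φ Ψ.symm (X i) = map φ (Ψ.symm (X i)) := by rw [baseChangeHom, aeval_X]
  rw [h1, baseChangeHom_map, AlgEquiv.apply_symm_apply, map_X]

/-- **Base change of a coordinate change**: for `Ψ ∈ Aut_k k[x]` and `φ : k → K`, the automorphism
`Ψ ⊗ K ∈ Aut_K K[x]`, `X_i ↦ map φ (Ψ X_i)`. (construction, derived here)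
[cite: CossartJannsenSaito2020, Lemma 2.27 (p. 30) (base change of the local data)] -/
def baseChange (Ψ : MvPolynomial σ k ≃ₐ[k] MvPolynomial σ k) :
    MvPolynomial σ K ≃ₐ[K] MvPolynomial σ K :=
  AlgEquiv.ofAlgHom (baseChangeHom φ Ψ) (baseChangeHom φ Ψ.symm) (baseChangeHom_comp_symm φ Ψ)
    (by simpa using baseChangeHom_comp_symm φ Ψ.symm)

/-- `(Ψ ⊗ K)(X_i) = map φ (Ψ X_i)`. [cite: CossartJannsenSaito2020, Lemma 2.27 (p. 30)] -/
theorem baseChange_X (Ψ : MvPolynomial σ k ≃ₐ[k] MvPolynomial σ k) (i : σ) :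
    baseChange φ Ψ (X i) = map φ (Ψ (X i)) := by
  change baseChangeHom φ Ψ (X i) = _
  rw [baseChangeHom, aeval_X]

/-- `(Ψ ⊗ K)(q ⊗ K) = (Ψ q) ⊗ K`. [cite: CossartJannsenSaito2020, Lemma 2.27 (p. 30)] -/
theorem baseChange_map (Ψ : MvPolynomial σ k ≃ₐ[k] MvPolynomial σ k) (q : MvPolynomial σ k) :
    baseChange φ Ψ (map φ q) = map φ (Ψ q) :=
  baseChangeHom_map φ Ψ q

/-- `(Ψ ⊗ K)⁻¹ (q ⊗ K) = (Ψ⁻¹ q) ⊗ K`. [cite: CossartJannsenSaito2020, Lemma 2.27 (p. 30)] -/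
theorem baseChange_symm_map (Ψ : MvPolynomial σ k ≃ₐ[k] MvPolynomial σ k) (q : MvPolynomial σ k) :
    (baseChange φ Ψ).symm (map φ q) = map φ (Ψ.symm q) :=
  baseChangeHom_map φ Ψ.symm q

variable {n : ℕ}

/-- **A centre base-changes to a centre with the same weights**: `(Ψ, γ)` admissible for `f` over `k` ⟹
`(Ψ ⊗ K, γ)` admissible for `f ⊗ K`. (derived here) [cite: CossartJannsenSaito2020, Lemma 2.27 (p. 30);
AbramovichTemkinWlodarczyk2024, Thm. 5.3.1 (3) (p. 1578) (functoriality)] -/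
theorem IsCentreFor.baseChange {f : MvPolynomial (Fin n) k} {Ψ : MvPolynomial (Fin n) k ≃ₐ[k] MvPolynomial (Fin n) k}
    {γ : Fin n → ℚ} (h : IsCentreFor f Ψ γ) : IsCentreFor (MvPolynomial.map φ f) (baseChange φ Ψ) γ := by
  refine ⟨fun i => ?_, h.2.1, fun d hd => ?_⟩
  · rw [baseChange_X, constantCoeff_map, h.1 i, map_zero]
  · rw [baseChange_symm_map] at hd
    exact h.2.2 d (support_map_subset _ _ hd)

/-- **`W_k(f) ⊆ W_K(f ⊗ K)`** for every map of fields `φ : k → K`. (derived here)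
[cite: CossartJannsenSaito2020, Lemma 2.27 (p. 30); AbramovichTemkinWlodarczyk2024, Thm. 5.3.1 (3) (p. 1578)] -/
theorem admissibleInvariants_subset_baseChange (f : MvPolynomial (Fin n) k) :
    admissibleInvariants f ⊆ admissibleInvariants (MvPolynomial.map φ f) := by
  rintro b ⟨Ψ, γ, h, rfl⟩
  exact ⟨baseChange φ Ψ, γ, h.baseChange φ, rfl⟩

/-- **A maximum over `K` attained over `k` is the maximum over `k`:** if `a = max W_K(f ⊗ K)` and
`a ∈ W_k(f)` then `a = max W_k(f)`.  (So a value certified over the bigger field, by a centre defined over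
the smaller one, is the value over both.) (derived here) [cite: CossartJannsenSaito2020, Lemma 2.27 (p. 30)] -/
theorem IsMaxInv.of_baseChange {f : MvPolynomial (Fin n) k} {a : List ℚ}
    (hK : IsMaxInv (admissibleInvariants (MvPolynomial.map φ f)) a) (ha : a ∈ admissibleInvariants f) :
    IsMaxInv (admissibleInvariants f) a :=
  ⟨ha, fun b hb => hK.2 b (admissibleInvariants_subset_baseChange φ f hb)⟩

end Literature.AlgebraicGeometry.Resolution.WeightedBlowup

end
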